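import Literature.MathematicalPhysics.StatisticalMechanics.BarlowStacking
import Literature.MathematicalPhysics.StatisticalMechanics.HaggStacking
import HarnessLib

/-!
# The hexagonal close packing is homogeneous (vertex-transitive) under translations and a half-turn

Topic: `Literature/MathematicalPhysics/StatisticalMechanics`.  API for `BarlowStacking.lean`: for every
point `p₀` of `hcpStacking a h` there is a linear isometry `B` of `ℝ³` (the identity for points of
even layers, the half-turn `(x, y, z) ↦ (−x, −y, z)` for points of odd layers) with
`hcpStacking a h = p₀ + B (hcpStacking a h)` — the space group of HCP (`P6₃/mmc`) acts transitively
on the points although HCP is not a Bravais lattice (`HcpNotBravais`).  Conway–Sloane Ch. 1 §1.3;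
Hales, Dense Sphere Packings §1.3 (the two HCP site classes are exchanged by a symmetry).
[folklore]

Use: route ThreeConeCertificate / crux `SlackRigidity` (stmt-AtomisticToContinuum-11960): its typed
conclusion matches environments to `x i + A (P.points)` with ONE `P` and particle-dependent LINEAR
isometries `A`, which forces any witness `P` to be vertex-transitive in exactly this sense
(`Cruxes/SlackRigidity/Disproof.lean`, `rigidFor_vertexTransitive`); this file certifies that the
intended witness HCP passes (as does FCC, a lattice), whereas dhcp/6H/9R do not.
-/

noncomputable section

namespace Literature.MathematicalPhysics.StatisticalMechanics

open Function

/-- Ambient space `ℝ³` (local abbreviation). [folklore] -/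
local notation "E3" => EuclideanSpace ℝ (Fin 3)

/-- The half-turn about the third axis as a function, `(v₀, v₁, v₂) ↦ (−v₀, −v₁, v₂)`. [folklore] -/
def halfTurnFun (v : E3) : E3 := !₂[-v 0, -v 1, v 2]

/-- First coordinate of the half-turn. [folklore] -/
@[simp] theorem halfTurnFun_apply_zero (v : E3) : halfTurnFun v 0 = -v 0 := by
  simp [halfTurnFun]

/-- Second coordinate of the half-turn. [folklore] -/
@[simp] theorem halfTurnFun_apply_one (v : E3) : halfTurnFun v 1 = -v 1 := by
  simp [halfTurnFun]

/-- Third coordinate of the half-turn. [folklore] -/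
@[simp] theorem halfTurnFun_apply_two (v : E3) : halfTurnFun v 2 = v 2 := by
  simp [halfTurnFun]

/-- The half-turn is an involution. [folklore] -/
theorem halfTurnFun_involutive : Involutive halfTurnFun := fun v => by
  ext l; fin_cases l <;> simp

/-- The half-turn as a linear map. [folklore] -/
def halfTurnLinear : E3 →ₗ[ℝ] E3 where
  toFun := halfTurnFun
  map_add' v w := by ext l; fin_cases l <;> simp <;> ring
  map_smul' c v := by ext l; fin_cases l <;> simp

/-- **The half-turn about the third axis** as a linear isometry equivalence of `ℝ³` (a proper
rotation by `π`). [folklore] -/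
def halfTurn : E3 ≃ₗᵢ[ℝ] E3 :=
  { LinearEquiv.ofInvolutive halfTurnLinear halfTurnFun_involutive with
    norm_map' := fun v => by
      change ‖halfTurnFun v‖ = ‖v‖
      simp only [EuclideanSpace.norm_eq, Fin.sum_univ_three, halfTurnFun_apply_zero,
        halfTurnFun_apply_one, halfTurnFun_apply_two, norm_neg] }

/-- The half-turn acts by `halfTurnFun`. [folklore] -/
@[simp] theorem halfTurn_apply (v : E3) : halfTurn v = halfTurnFun v := rfl

/-- The half-turn is its own inverse. [folklore] -/
@[simp] theorem halfTurn_symm_apply (v : E3) : halfTurn.symm v = halfTurnFun v := by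
  apply halfTurn.injective
  rw [LinearIsometryEquiv.apply_symm_apply, halfTurn_apply]
  exact (halfTurnFun_involutive v).symm

section Hcp

variable (a h : ℝ)

/-- HCP layer labels of even layers vanish. [folklore] -/
theorem haggLabel_alternating_of_even {m : ℤ} (hm : Even m) : haggLabel alternatingHagg m = 0 := by
  rw [haggLabel_alternating, if_pos hm]

/-- HCP layer labels of odd layers are `1`. [folklore] -/
theorem haggLabel_alternating_of_odd {m : ℤ} (hm : Odd m) : haggLabel alternatingHagg m = 1 := by
  rw [haggLabel_alternating, if_neg (Int.not_even_iff_odd.2 hm)]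

/-- **Translating HCP by a point of an even layer returns HCP**:
`barlowPos k i j + barlowPos k' i' j' = barlowPos (k + k') (i + i') (j + j')` for even `k`. [folklore] -/
theorem hcp_add_of_even {k : ℤ} (hk : Even k) (i j k' i' j' : ℤ) :
    barlowPos a h alternatingHagg k i j + barlowPos a h alternatingHagg k' i' j' =
      barlowPos a h alternatingHagg (k + k') (i + i') (j + j') := by
  rcases Int.even_or_odd k' with hk' | hk'
  · have h1 := haggLabel_alternating_of_even hk
    have h2 := haggLabel_alternating_of_even hk'
    have h3 := haggLabel_alternating_of_even (hk.add hk')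
    ext l; fin_cases l <;> simp [h1, h2, h3] <;> ring
  · have h1 := haggLabel_alternating_of_even hk
    have h2 := haggLabel_alternating_of_odd hk'
    have h3 := haggLabel_alternating_of_odd (hk.add_odd hk')
    ext l; fin_cases l <;> simp [h1, h2, h3] <;> ring

/-- **Translating the half-turned HCP by a point of an odd layer returns HCP**:
`barlowPos k i j + halfTurn (barlowPos k' i' j') = barlowPos (k + k') (i − i') (j − j')` for odd `k`.
[folklore] -/
theorem hcp_add_halfTurn_of_odd {k : ℤ} (hk : Odd k) (i j k' i' j' : ℤ) :
    barlowPos a h alternatingHagg k i j + halfTurn (barlowPos a h alternatingHagg k' i' j') =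
      barlowPos a h alternatingHagg (k + k') (i - i') (j - j') := by
  rcases Int.even_or_odd k' with hk' | hk'
  · have h1 := haggLabel_alternating_of_odd hk
    have h2 := haggLabel_alternating_of_even hk'
    have h3 := haggLabel_alternating_of_odd (hk.add_even hk')
    ext l; fin_cases l <;> simp [h1, h2, h3] <;> ring
  · have h1 := haggLabel_alternating_of_odd hk
    have h2 := haggLabel_alternating_of_odd hk'
    have h3 := haggLabel_alternating_of_even (hk.add_odd hk')
    ext l; fin_cases l <;> simp [h1, h2, h3] <;> ring

/-- **HCP is homogeneous**: for every point `p₀` of `hcpStacking a h` there is a linear isometry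
`B` of `ℝ³` (identity or half-turn) with `q ∈ HCP ↔ p₀ + B q ∈ HCP`; i.e. the environment of every
point is congruent, by a linear isometry, to the environment of the origin. (No hypothesis on
`a, h`: a purely combinatorial identity of the stacking.) [folklore] -/
theorem hcpStacking_homogeneous {p₀ : EuclideanSpace ℝ (Fin 3)} (hp₀ : p₀ ∈ hcpStacking a h) :
    ∃ B : EuclideanSpace ℝ (Fin 3) ≃ₗᵢ[ℝ] EuclideanSpace ℝ (Fin 3),
      ∀ q, q ∈ hcpStacking a h ↔ p₀ + B q ∈ hcpStacking a h := by
  obtain ⟨k, i, j, rfl⟩ := hp₀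
  rcases Int.even_or_odd k with hk | hk
  · refine ⟨LinearIsometryEquiv.refl ℝ _, fun q => ⟨?_, ?_⟩⟩
    · rintro ⟨k', i', j', rfl⟩
      exact ⟨k + k', i + i', j + j', by
        rw [LinearIsometryEquiv.coe_refl, id, hcp_add_of_even a h hk]⟩
    · rintro ⟨k', i', j', hq⟩
      rw [LinearIsometryEquiv.coe_refl, id] at hq
      refine ⟨k' + -k, i' + -i, j' + -j, ?_⟩
      have hneg : Even (-k) := hk.neg
      have e := hcp_add_of_even a h hneg (-i) (-j) k' i' j'
      -- `barlowPos (-k) (-i) (-j) = - barlowPos k i j`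
      have hrefl : barlowPos a h alternatingHagg (-k) (-i) (-j) =
          -barlowPos a h alternatingHagg k i j := by
        have h0 := hcp_add_of_even a h hk i j (-k) (-i) (-j)
        have hz : barlowPos a h alternatingHagg (k + -k) (i + -i) (j + -j) = 0 := by
          simp [barlowPos]
        rw [hz] at h0
        exact (neg_eq_of_add_eq_zero_right h0).symm
      calc q = -barlowPos a h alternatingHagg k i j + (barlowPos a h alternatingHagg k i j + q) := by abel
        _ = barlowPos a h alternatingHagg (-k) (-i) (-j) + barlowPos a h alternatingHagg k' i' j' := by
            rw [hq, hrefl]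
        _ = _ := by rw [e]; ring_nf
  · refine ⟨halfTurn, fun q => ⟨?_, ?_⟩⟩
    · rintro ⟨k', i', j', rfl⟩
      exact ⟨k + k', i - i', j - j', by rw [hcp_add_halfTurn_of_odd a h hk]⟩
    · rintro ⟨k', i', j', hq⟩
      -- `q = halfTurn (barlowPos k' i' j' - barlowPos k i j)`
      have hq' : q = halfTurn (barlowPos a h alternatingHagg k' i' j' - barlowPos a h alternatingHagg k i j) := by
        have : halfTurn q = barlowPos a h alternatingHagg k' i' j' - barlowPos a h alternatingHagg k i j := by
          rw [← hq]; abel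
        calc q = halfTurn.symm (halfTurn q) := (halfTurn.symm_apply_apply q).symm
          _ = _ := by rw [this, halfTurn_symm_apply, ← halfTurn_apply]
      refine ⟨k' - k, i - i', j - j', ?_⟩
      rw [hq']
      rcases Int.even_or_odd k' with hk' | hk'
      · have h1 := haggLabel_alternating_of_odd hk
        have h2 := haggLabel_alternating_of_even hk'
        have h3 := haggLabel_alternating_of_odd (hk'.sub_odd hk)
        ext l; fin_cases l <;> simp [h1, h2, h3] <;> ring
      · have h1 := haggLabel_alternating_of_odd hk
        have h2 := haggLabel_alternating_of_odd hk'
        have h3 := haggLabel_alternating_of_even (hk'.sub_odd hk)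
        ext l; fin_cases l <;> simp [h1, h2, h3] <;> ring

/-- The same for the HCP periodic configuration of the tree (`a, h ≠ 0`). [folklore] -/
theorem hcpPeriodicConfiguration_homogeneous (ha : a ≠ 0) (hh : h ≠ 0)
    {p₀ : EuclideanSpace ℝ (Fin 3)} (hp₀ : p₀ ∈ (hcpPeriodicConfiguration ha hh).points) :
    ∃ B : EuclideanSpace ℝ (Fin 3) ≃ₗᵢ[ℝ] EuclideanSpace ℝ (Fin 3),
      ∀ q, q ∈ (hcpPeriodicConfiguration ha hh).points ↔
        p₀ + B q ∈ (hcpPeriodicConfiguration ha hh).points := by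
  rw [hcpPeriodicConfiguration_points] at hp₀ ⊢
  exact hcpStacking_homogeneous a h hp₀

end Hcp

end Literature.MathematicalPhysics.StatisticalMechanics

end
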